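import Literature.AnabelianGeometry.Anabelioids.TerminalCoproductComponents

/-!
# The fundamental group acts trivially on the fibre of a trivial object

Mathlib-level lemmas for the anabelioid dictionary ([SGA1, Exp. V §4–5]): for a functor
`F : C ⥤ FintypeCat` and an automorphism `σ ∈ Aut F` (an element of the fundamental group when `F`
is a fibre functor of a Galois category),

* `app_map_eq_of_subsingleton`: `σ` fixes every point of `F X` of the form `F(s)(t)` for a
  "section" `s : T ⟶ X` from an object `T` with one-point fibre (naturality of `σ` at `s`);
* `subsingleton_fiber_terminal`: the fibre of `1` is a point;
* `app_sigma_terminal_eq`: hence `Aut F` acts TRIVIALLY on the fibre of the trivial object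
  `∐_{j ∈ J} 1` (every point is hit by a summand `1 ⟶ ∐ 1`).

This is the fact "`Π_𝕂` acts trivially on the sheets of a covering that is trivial over `𝕂`" in the
proof of [SemiAnbd] Proposition 2.6 (p. 29).  Proof-only, no definitions.
-/

namespace Literature.AnabelianGeometry.Anabelioids

open CategoryTheory CategoryTheory.Limits CategoryTheory.PreGaloisCategory

universe w u₂ u₁

variable {C : Type u₁} [Category.{u₂} C]

/-- An automorphism of `F` fixes the image of a point of a one-point fibre under any morphism
(naturality). [cite: SGA1, Exp. V §4 (condition (G4))] -/
theorem app_map_eq_of_subsingleton (F : C ⥤ FintypeCat.{w}) (σ : Aut F) {T X : C}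
    [Subsingleton (F.obj T)] (s : T ⟶ X) (t : F.obj T) :
    σ.hom.app X (F.map s t) = F.map s t := by
  -- naturality of `σ.hom` at `s`
  have hn : F.map s ≫ σ.hom.app X = σ.hom.app T ≫ F.map s := σ.hom.naturality s
  have h1 : (F.map s ≫ σ.hom.app X) t = (σ.hom.app T ≫ F.map s) t := by rw [hn]
  change σ.hom.app X (F.map s t) = F.map s (σ.hom.app T t) at h1
  rw [h1, Subsingleton.elim (σ.hom.app T t) t]

variable [GaloisCategory C]

/-- The fibre of the terminal object of a Galois category is a single point.
[cite: SGA1, Exp. V §4 (condition (G4))] -/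
theorem subsingleton_fiber_terminal (F : C ⥤ FintypeCat.{w}) [FiberFunctor F] :
    Subsingleton (F.obj (⊤_ C)) := by
  obtain ⟨e⟩ := nonempty_equiv_fiber_terminal_punit F
  exact e.subsingleton

/-- **`Aut F` acts trivially on the fibre of a trivial object `∐_J 1`**: every point of the fibre is
the image of the point of `1` under a summand inclusion, which commutes with `σ`.
[cite: SGA1, Exp. V §5] -/
theorem app_sigma_terminal_eq (F : C ⥤ FintypeCat.{w}) [FiberFunctor F] (J : Type w) [Finite J]
    (σ : Aut F) (x : F.obj (∐ fun _ : J => ⊤_ C)) :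
    σ.hom.app (∐ fun _ : J => ⊤_ C) x = x := by
  haveI := subsingleton_fiber_terminal F
  obtain ⟨⟨j⟩, y, hy⟩ := Concrete.isColimit_exists_rep _
    (isColimitOfPreserves F (colimit.isColimit (Discrete.functor fun _ : J => ⊤_ C))) x
  obtain ⟨y, rfl⟩ : ∃ y' : F.obj (⊤_ C), y' = y := ⟨y, rfl⟩
  rw [← hy]
  exact app_map_eq_of_subsingleton F σ (Sigma.ι (fun _ : J => ⊤_ C) j) y

/-- Corollary in group form: the permutation of `F(∐_J 1)` induced by any `σ ∈ Aut F` is the identity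
(the action homomorphism `Aut F → Perm (F (∐ 1))` is trivial). [cite: SGA1, Exp. V §5] -/
theorem app_sigma_terminal_eq_id (F : C ⥤ FintypeCat.{w}) [FiberFunctor F] (J : Type w) [Finite J]
    (σ : Aut F) : (σ.hom.app (∐ fun _ : J => ⊤_ C) : F.obj _ → F.obj _) = id :=
  funext (app_sigma_terminal_eq F J σ)

end Literature.AnabelianGeometry.Anabelioids
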